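import Summits.CriticalPhenomena.PercolationContinuityZ3.Theorems.PercNearOneGluingNoHeavyLowerTailTwoPartitionWeightedBase
import HarnessLib.Audit

/-!
# `NoHeavyLowerTail` (crux stmt-CriticalPhenomena-4575), master-family hierarchy P3 (gen 27): the EXTREME RAYS of the weighted base —
# `WeightedBase` follows from a counting inequality `WB4` about four up-sets (integer layer cake), in the kernel

Support file (seat `prim-masterthm-p3`; `--supports stmt-CriticalPhenomena-4575`; memos
`run/shared/lean/prim/prim-masterthm/FROM-prim-masterthm-p3-g26-JUNTA-LIFT-AND-K6-CENSUS.md` §5.1 and `FROM-prim-masterthm-p3-g27-KEY-TWO-LAYER.md` §5,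
`KEY-REDUCTION-g26.md` §2).

THE STEP (gen 26 on paper; this file in the kernel).  `WeightedBase` asks `0 ≤ wbForm F ℬ 𝒞` for every MONOTONE integer weight `F` with
`F(S) + F(Sᶜ) ≥ 0`.  Every such `F` is a finite sum of RAYS `1_𝒜 − 1_{ℰᶜˢ}` with `ℰ ⊆ 𝒜` up-sets (integer layer cake: `𝒜_t = {F ≥ t+1}`,
`ℰ_t = {S : F(Sᶜ) ≤ −(t+1)}`, `t < M`), `wbForm` is linear in the weight, and at a ray

  `wbForm (1_𝒜 − 1_{ℰᶜˢ}) ℬ 𝒞 = 2·#(𝒜ℬ𝒞) + #(ℰℬ𝒞ᶜˢ) + #(ℰ𝒞ℬᶜˢ) − #(𝒜ℬ𝒞ᶜˢ) − #(𝒜𝒞ℬᶜˢ) − 2·#(ℰℬᶜˢ𝒞ᶜˢ)`      (`wbForm_ray`).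

Hence **`WB4 → WeightedBase`** (`weightedBase_of_wb4`), where `WB4` is the counting inequality "the right-hand side above is `≥ 0` for all up-sets
`ℰ ⊆ 𝒜`, `ℬ`, `𝒞`" (`@[conjecture]`; `ℰ = ∅` is Harris–Kleitman twice, `ℰ = 𝒜` is Harris–Kleitman once, `ℰ = 𝒜 ∖ 𝒜ᶜˢ` is `ThreeSetAntipodal`;
equivalent to `WeightedBase` by the converse direction, which is immediate).  Together with the tree: `WB4 → WeightedBase → ThreeSetAntipodal → SQKD`.
On paper (gen 26, KEY-REDUCTION §3–4) `WB4` follows from the two-up-set matching statement `KeySandwich` (`…TwoPartitionKey`) by Picard's closure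
duality and a one-sided decoupling; that step is not in this file.
HONEST LABEL: a reduction between two open statements; nothing here bears on the crux or on Sahi's `C₃`. [this work]
-/

namespace Summit.CriticalPhenomena.PercolationContinuityZ3.Theorems.TwoPartition

open Finset
open scoped FinsetFamily

variable {α : Type*} [DecidableEq α] [Fintype α]

/-- **CONJECTURE `WB4`** (gen 26; open): for up-sets `ℰ ⊆ 𝒜`, `ℬ`, `𝒞` of a finite cube,
`#(𝒜ℬ𝒞ᶜˢ) + #(𝒜𝒞ℬᶜˢ) + 2·#(ℰℬᶜˢ𝒞ᶜˢ) ≤ 2·#(𝒜ℬ𝒞) + #(ℰℬ𝒞ᶜˢ) + #(ℰ𝒞ℬᶜˢ)`.  The extreme rays of `WeightedBase`; implied on paper by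
`KeySandwich`.  An obligation / hypothesis — never a fact. [this work] [status: open] -/
@[conjecture] def WB4 : Prop :=
  ∀ (n : ℕ) (𝒜 ℰ ℬ 𝒞 : Finset (Finset (Fin n))), IsUpperSet (𝒜 : Set (Finset (Fin n))) → IsUpperSet (ℰ : Set (Finset (Fin n))) →
    IsUpperSet (ℬ : Set (Finset (Fin n))) → IsUpperSet (𝒞 : Set (Finset (Fin n))) → ℰ ⊆ 𝒜 →
      (#(𝒜 ∩ ℬ ∩ 𝒞ᶜˢ) : ℤ) + #(𝒜 ∩ 𝒞 ∩ ℬᶜˢ) + 2 * #(ℰ ∩ ℬᶜˢ ∩ 𝒞ᶜˢ) ≤ 2 * #(𝒜 ∩ ℬ ∩ 𝒞) + #(ℰ ∩ ℬ ∩ 𝒞ᶜˢ) + #(ℰ ∩ 𝒞 ∩ ℬᶜˢ)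

/-- The ray weight `1_𝒜 − 1_{ℰᶜˢ}`: `+1` on `𝒜`, minus `1` where the complement lies in `ℰ`. [this work] -/
def rayWeight (𝒜 ℰ : Finset (Finset α)) (S : Finset α) : ℤ := (if S ∈ 𝒜 then 1 else 0) - (if Sᶜ ∈ ℰ then 1 else 0)

/-! ### `wbForm` is linear in the weight -/

omit [Fintype α] in
/-- `wbForm` is additive in the weight. [this work] -/
theorem wbForm_add [Fintype α] (f g : Finset α → ℤ) (ℬ 𝒞 : Finset (Finset α)) :
    wbForm (fun S => f S + g S) ℬ 𝒞 = wbForm f ℬ 𝒞 + wbForm g ℬ 𝒞 := by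
  unfold wbForm
  simp only [Finset.sum_add_distrib]
  ring

omit [Fintype α] in
/-- `wbForm` of a finite sum of weights is the sum of the `wbForm`s. [this work] -/
theorem wbForm_sum [Fintype α] {ι : Type*} [DecidableEq ι] (s : Finset ι) (f : ι → Finset α → ℤ) (ℬ 𝒞 : Finset (Finset α)) :
    wbForm (fun S => ∑ t ∈ s, f t S) ℬ 𝒞 = ∑ t ∈ s, wbForm (f t) ℬ 𝒞 := by
  induction s using Finset.induction_on with
  | empty => simp [wbForm]
  | insert a s ha ih =>
    rw [Finset.sum_insert ha, ← ih, ← wbForm_add]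
    congr 1
    funext S
    rw [Finset.sum_insert ha]

/-! ### The value of `wbForm` at a ray -/

/-- `wbForm` at the ray `1_𝒜 − 1_{ℰᶜˢ}` in terms of six cardinalities. [this work] -/
theorem wbForm_ray (𝒜 ℰ ℬ 𝒞 : Finset (Finset α)) :
    wbForm (rayWeight 𝒜 ℰ) ℬ 𝒞 = 2 * #(𝒜 ∩ ℬ ∩ 𝒞) + #(ℰ ∩ ℬ ∩ 𝒞ᶜˢ) + #(ℰ ∩ 𝒞 ∩ ℬᶜˢ)
      - #(𝒜 ∩ ℬ ∩ 𝒞ᶜˢ) - #(𝒜 ∩ 𝒞 ∩ ℬᶜˢ) - 2 * #(ℰ ∩ ℬᶜˢ ∩ 𝒞ᶜˢ) := by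
  unfold wbForm rayWeight
  -- the two sums as indicator counts
  have e1 : (#(𝒜 ∩ ℬ ∩ 𝒞) : ℤ) = ∑ S ∈ ℬ ∩ 𝒞, if S ∈ 𝒜 then 1 else 0 := by
    rw [show 𝒜 ∩ ℬ ∩ 𝒞 = (ℬ ∩ 𝒞) ∩ 𝒜 from by ext; simp [and_comm, and_left_comm], card_inter_eq_sum_ite]
  have e2 : (#(ℰ ∩ ℬᶜˢ ∩ 𝒞ᶜˢ) : ℤ) = ∑ S ∈ ℬ ∩ 𝒞, if Sᶜ ∈ ℰ then 1 else 0 := by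
    rw [← card_compls (ℰ ∩ ℬᶜˢ ∩ 𝒞ᶜˢ), compls_inter, compls_inter, compls_compls, compls_compls,
      show ℰᶜˢ ∩ ℬ ∩ 𝒞 = (ℬ ∩ 𝒞) ∩ ℰᶜˢ from by ext; simp [and_comm, and_left_comm], card_inter_eq_sum_ite]
    refine Finset.sum_congr rfl fun S _ => ?_
    simp only [mem_compls]
  have e3 : (#(𝒜 ∩ ℬ ∩ 𝒞ᶜˢ) : ℤ) = ∑ S ∈ ℬ ∩ 𝒞ᶜˢ, if S ∈ 𝒜 then 1 else 0 := by
    rw [show 𝒜 ∩ ℬ ∩ 𝒞ᶜˢ = (ℬ ∩ 𝒞ᶜˢ) ∩ 𝒜 from by ext; simp [and_comm, and_left_comm], card_inter_eq_sum_ite]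
  have e4 : (#(ℰ ∩ 𝒞 ∩ ℬᶜˢ) : ℤ) = ∑ S ∈ ℬ ∩ 𝒞ᶜˢ, if Sᶜ ∈ ℰ then 1 else 0 := by
    rw [← card_compls (ℰ ∩ 𝒞 ∩ ℬᶜˢ), compls_inter, compls_inter, compls_compls,
      show ℰᶜˢ ∩ 𝒞ᶜˢ ∩ ℬ = (ℬ ∩ 𝒞ᶜˢ) ∩ ℰᶜˢ from by ext; simp [and_comm, and_left_comm], card_inter_eq_sum_ite]
    refine Finset.sum_congr rfl fun S _ => ?_
    simp only [mem_compls]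
  have e5 : (#(𝒜 ∩ 𝒞 ∩ ℬᶜˢ) : ℤ) = ∑ S ∈ ℬ ∩ 𝒞ᶜˢ, if Sᶜ ∈ 𝒜 then 1 else 0 := by
    rw [← card_compls (𝒜 ∩ 𝒞 ∩ ℬᶜˢ), compls_inter, compls_inter, compls_compls,
      show 𝒜ᶜˢ ∩ 𝒞ᶜˢ ∩ ℬ = (ℬ ∩ 𝒞ᶜˢ) ∩ 𝒜ᶜˢ from by ext; simp [and_comm, and_left_comm], card_inter_eq_sum_ite]
    refine Finset.sum_congr rfl fun S _ => ?_
    simp only [mem_compls]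
  have e6 : (#(ℰ ∩ ℬ ∩ 𝒞ᶜˢ) : ℤ) = ∑ S ∈ ℬ ∩ 𝒞ᶜˢ, if S ∈ ℰ then 1 else 0 := by
    rw [show ℰ ∩ ℬ ∩ 𝒞ᶜˢ = (ℬ ∩ 𝒞ᶜˢ) ∩ ℰ from by ext; simp [and_comm, and_left_comm], card_inter_eq_sum_ite]
  simp only [compl_compl, Finset.sum_add_distrib, Finset.sum_sub_distrib]
  rw [← e1, ← e2, ← e3, ← e4, ← e5, ← e6]
  ring

/-! ### The integer layer cake -/

/-- Clamped layer-cake identity for an integer: `∑_{t<M} ([t+1 ≤ k] − [k ≤ −(t+1)]) = max(−M, min(M, k))`. [this work] -/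
theorem sum_range_layer (k : ℤ) (M : ℕ) :
    ∑ t ∈ range M, ((if (t:ℤ) + 1 ≤ k then (1:ℤ) else 0) - (if k ≤ -((t:ℤ) + 1) then 1 else 0)) = max (-(M:ℤ)) (min (M:ℤ) k) := by
  induction M with
  | zero => simp
  | succ m ih =>
    rw [Finset.sum_range_succ, ih]
    push_cast
    by_cases h1 : (m:ℤ) + 1 ≤ k
    · have h2 : ¬ k ≤ -((m:ℤ) + 1) := by omega
      rw [if_pos h1, if_neg h2]
      have : max (-(m:ℤ)) (min (m:ℤ) k) = m := by
        rw [min_eq_left (by omega), max_eq_right (by omega)]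
      rw [this]
      rw [max_eq_right (by omega : -((m:ℤ)+1) ≤ min ((m:ℤ)+1) k), min_eq_left (by omega)]
      ring
    · rw [if_neg h1]
      by_cases h2 : k ≤ -((m:ℤ) + 1)
      · rw [if_pos h2]
        have : max (-(m:ℤ)) (min (m:ℤ) k) = -m := by
          rw [min_eq_right (by omega), max_eq_left (by omega)]
        rw [this, min_eq_right (by omega : k ≤ (m:ℤ) + 1), max_eq_left (by omega)]
        ring
      · rw [if_neg h2]
        have : max (-(m:ℤ)) (min (m:ℤ) k) = k := by
          rw [min_eq_right (by omega), max_eq_right (by omega)]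
        rw [this, min_eq_right (by omega : k ≤ (m:ℤ) + 1), max_eq_right (by omega)]
        ring

/-- The layer-cake identity for an integer weight: `F = ∑_{t<M} rayWeight 𝒜_t ℰ_t` pointwise, once `M ≥ |F S|`, with
`𝒜_t = {F ≥ t+1}` and `ℰ_t = {R : F(Rᶜ) ≤ −(t+1)}`. [this work] -/
theorem layer_cake (F : Finset α → ℤ) (M : ℕ) (S : Finset α) (hM : |F S| ≤ M) :
    F S = ∑ t ∈ range M, rayWeight (univ.filter fun R => (t:ℤ) + 1 ≤ F R) (univ.filter fun R => F Rᶜ ≤ -((t:ℤ) + 1)) S := by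
  unfold rayWeight
  simp only [mem_filter, mem_univ, true_and, compl_compl]
  rw [sum_range_layer]
  have h1 : -(M:ℤ) ≤ F S := by have := neg_abs_le (F S); omega
  have h2 : F S ≤ M := (le_abs_self _).trans hM
  rw [min_eq_right h2, max_eq_right h1]

/-! ### `WB4 → WeightedBase` -/

/-- **`WB4 ⟹ WeightedBase`** (this work): a monotone integer weight with `F + F∘σ ≥ 0` is a sum of rays `1_{𝒜_t} − 1_{ℰ_tᶜˢ}` with up-sets
`ℰ_t ⊆ 𝒜_t`, `wbForm` is additive, and `WB4` is `wbForm ≥ 0` at every ray. [this work] -/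
theorem weightedBase_of_wb4 (h : WB4) : WeightedBase := by
  intro n F ℬ 𝒞 hF hFσ hℬ h𝒞
  classical
  -- a bound M on |F|
  obtain ⟨M, hM⟩ : ∃ M : ℕ, ∀ S : Finset (Fin n), |F S| ≤ M := by
    refine ⟨univ.sup fun S => (F S).natAbs, fun S => ?_⟩
    have h1 : (F S).natAbs ≤ univ.sup fun S => (F S).natAbs := Finset.le_sup (f := fun S => (F S).natAbs) (mem_univ S)
    have h2 : |F S| = ((F S).natAbs : ℤ) := (Int.natCast_natAbs (F S)).symm
    rw [h2]; exact_mod_cast h1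
  set 𝒜 : ℕ → Finset (Finset (Fin n)) := fun t => univ.filter fun R => (t:ℤ) + 1 ≤ F R with h𝒜
  set ℰ : ℕ → Finset (Finset (Fin n)) := fun t => univ.filter fun R => F Rᶜ ≤ -((t:ℤ) + 1) with hℰ
  have hFeq : F = fun S => ∑ t ∈ range M, rayWeight (𝒜 t) (ℰ t) S := by
    funext S; exact layer_cake F M S (hM S)
  rw [hFeq, wbForm_sum]
  refine Finset.sum_nonneg fun t _ => ?_
  -- each ray is an instance of WB4
  have hAup : IsUpperSet (𝒜 t : Set (Finset (Fin n))) := by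
    intro R R' hRR' hR
    rw [Finset.mem_coe, h𝒜, mem_filter] at hR ⊢
    exact ⟨mem_univ _, hR.2.trans (hF hRR')⟩
  have hEup : IsUpperSet (ℰ t : Set (Finset (Fin n))) := by
    intro R R' hRR' hR
    rw [Finset.mem_coe, hℰ, mem_filter] at hR ⊢
    exact ⟨mem_univ _, (hF (compl_subset_compl.2 hRR')).trans hR.2⟩
  have hEA : ℰ t ⊆ 𝒜 t := by
    intro R hR
    rw [hℰ, mem_filter] at hR
    rw [h𝒜, mem_filter]
    have := hFσ R
    exact ⟨mem_univ _, by linarith [hR.2]⟩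
  have hray := h n (𝒜 t) (ℰ t) ℬ 𝒞 hAup hEup hℬ h𝒞 hEA
  rw [wbForm_ray]
  linarith

/-- The converse direction: `WeightedBase ⟹ WB4` (each ray is an admissible weight), so the two are equivalent. [this work] -/
theorem wb4_of_weightedBase (h : WeightedBase) : WB4 := by
  intro n 𝒜 ℰ ℬ 𝒞 h𝒜 hℰ hℬ h𝒞 hEA
  have hmono : Monotone (rayWeight 𝒜 ℰ) := by
    intro S T hST
    unfold rayWeight
    have h1 : S ∈ 𝒜 → T ∈ 𝒜 := fun hS => h𝒜 hST hS
    have h2 : Tᶜ ∈ ℰ → Sᶜ ∈ ℰ := fun hT => hℰ (compl_subset_compl.2 hST) hT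
    by_cases a : S ∈ 𝒜 <;> by_cases b : T ∈ 𝒜 <;> by_cases c : Sᶜ ∈ ℰ <;> by_cases d : Tᶜ ∈ ℰ <;>
      simp only [a, b, c, d] <;> simp_all
  have hsum : ∀ S, 0 ≤ rayWeight 𝒜 ℰ S + rayWeight 𝒜 ℰ Sᶜ := by
    intro S
    unfold rayWeight
    rw [compl_compl]
    have h1 : Sᶜ ∈ ℰ → Sᶜ ∈ 𝒜 := fun hS => hEA hS
    have h2 : S ∈ ℰ → S ∈ 𝒜 := fun hS => hEA hS
    by_cases a : S ∈ 𝒜 <;> by_cases b : Sᶜ ∈ 𝒜 <;> by_cases c : Sᶜ ∈ ℰ <;> by_cases d : S ∈ ℰ <;>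
      simp only [a, b, c, d] <;> simp_all
  have := h n (rayWeight 𝒜 ℰ) ℬ 𝒞 hmono hsum hℬ h𝒞
  rw [wbForm_ray] at this
  linarith

end Summit.CriticalPhenomena.PercolationContinuityZ3.Theorems.TwoPartition
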